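import Literature.Computability.AlgebraicComplexity.BILPS19MinrankVarieties
import HarnessLib

/-!
# BILPS 2019 Thm 27 (equations for the minrank varieties `𝓜_r`): the slice `k = dim U = 1`

Bläser–Ikenmeyer–Lysikov–Pandey–Schreyer 2019, Thm. 27 (held text `paper:arxiv-1911.02534`
p0026:L36; tree fact `BILPS2019_thm27`, typed WEAKER as the existence of a nontrivial equation of
`𝓜_r ⊆ U ⊗ V ⊗ W` that is homogeneous of degree `k·m`, for `m ≤ n`, `m, n > kr`, under `LRC(k, m)`).
For `k = dim U = 1` a tensor is a single `m × n` matrix `T₁`, `𝓜_r = {rk T₁ ≤ r}` (a nonzero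
`x ∈ U* = F` only rescales), and the degree-`m` equation is an `(r+1) × (r+1)` minor padded by a
monomial of degree `m - r - 1` (`BILPS2019_thm27_of_k_eq_one`). The hypothesis `LRC(1, m)` holds for
every `m` (`BILPS2019.latinRectangleCondition_one`, sibling file
`BILPS19LatinRectangleConditionProofs.lean`), so this slice of the typed implication is witnessed
non-vacuously. The printed theorem (every `k`, highest-weight vectors of type
`((k×m),(m×k),(m×k))`) is NOT proved here; nothing here bears on `VP ≠ VNP`.

## References
* [BlaserIkenmeyerLysikovPandeySchreyer2019] arXiv:1911.02534, §7.3 Thm. 27 (p0026:L36) and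
  Def. 15 (`𝓜_r`, p0023:L29).
-/

noncomputable section

open MvPolynomial Finset

namespace Literature.Computability.AlgebraicComplexity

namespace BILPS2019

variable {F : Type*} [Field F]

/-- Homogeneous polynomials are closed under negation. [folklore] -/
private theorem isHomogeneous_neg {τ : Type*} {p : MvPolynomial τ F} {d : ℕ} (hp : p.IsHomogeneous d) :
    (-p).IsHomogeneous d := by
  rw [← mem_homogeneousSubmodule] at hp ⊢
  exact (homogeneousSubmodule τ F d).neg_mem hp

/-- The determinant of a square matrix of (not necessarily distinct) variables is homogeneous of
degree the size of the matrix (Leibniz expansion). [folklore] -/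
private theorem isHomogeneous_det_X {ι : Type*} [Fintype ι] [DecidableEq ι] {τ : Type*}
    (v : ι → ι → τ) :
    (Matrix.det (Matrix.of fun i j : ι => (X (v i j) : MvPolynomial τ F))).IsHomogeneous
      (Fintype.card ι) := by
  rw [Matrix.det_apply]
  refine IsHomogeneous.sum _ _ _ fun σ _ => ?_
  have hp : (∏ i, (Matrix.of fun i j : ι => (X (v i j) : MvPolynomial τ F)) (σ i) i).IsHomogeneous
      (Fintype.card ι) := by
    have := IsHomogeneous.prod (s := Finset.univ)
      (φ := fun i => (X (v (σ i) i) : MvPolynomial τ F)) (n := fun _ => 1)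
      (fun i _ => isHomogeneous_X F (v (σ i) i))
    simpa using this
  rcases Int.units_eq_one_or (Equiv.Perm.sign σ) with h | h
  · rw [h, one_smul]; exact hp
  · rw [h, Units.neg_smul, one_smul]; exact isHomogeneous_neg hp

/-- A square submatrix larger than the rank has vanishing determinant. [folklore] -/
private theorem det_submatrix_eq_zero_of_rank_le {m n r : ℕ} (N : Matrix (Fin m) (Fin n) F)
    (hN : N.rank ≤ r) (f : Fin (r + 1) → Fin m) (g : Fin (r + 1) → Fin n) :
    (N.submatrix f g).det = 0 := by
  by_contra hdet
  have hU : IsUnit (N.submatrix f g) :=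
    (Matrix.isUnit_iff_isUnit_det _).mpr (isUnit_iff_ne_zero.mpr hdet)
  have h1 := Matrix.rank_of_isUnit _ hU
  have h2 := Matrix.rank_submatrix_le N f g
  rw [h1, Fintype.card_fin] at h2
  omega

/-- **BILPS Thm 27 for `k = dim U = 1`** (typed form): for `m ≤ n`, `r < m`, `r < n` (and
`LRC(1, m)`, which always holds) the padded minor `det (X_{0,i,j})_{i,j ≤ r} · X_{0,0,0}^{m-r-1}` is a
nonzero equation of `𝓜_r ⊆ F^{1 × m × n}`, homogeneous of degree `1·m`.
[cite: BlaserIkenmeyerLysikovPandeySchreyer2019, Thm. 27 (case k = 1)] -/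
theorem BILPS2019_thm27_of_k_eq_one (F : Type) [Field F] [IsAlgClosed F] [CharZero F] (m n r : ℕ)
    (_hmn : m ≤ n) (hm : 1 * r < m) (hn : 1 * r < n) (_hL : latinRectangleCondition 1 m) :
    ∃ f : MvPolynomial (Fin 1 × Fin m × Fin n) F, f ≠ 0 ∧ f.IsHomogeneous (1 * m) ∧
      ∀ T ∈ (minrankSet F r : Set (Fin 1 → Fin m → Fin n → F)), eval (trilinearPt T) f = 0 := by
  classical
  rw [one_mul] at hm hn ⊢
  -- the leading `(r+1) × (r+1)` minor of the single slice
  obtain ⟨ρm, hρm⟩ : ∃ ρm : Fin (r + 1) → Fin m, ∀ i, (ρm i : ℕ) = i :=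
    ⟨Fin.castLE (by omega), fun i => rfl⟩
  obtain ⟨ρn, hρn⟩ : ∃ ρn : Fin (r + 1) → Fin n, ∀ i, (ρn i : ℕ) = i :=
    ⟨Fin.castLE (by omega), fun i => rfl⟩
  set M : Matrix (Fin (r + 1)) (Fin (r + 1)) (MvPolynomial (Fin 1 × Fin m × Fin n) F) :=
    Matrix.of fun i j => X ((0 : Fin 1), ρm i, ρn j) with hM
  set x₀ : Fin 1 × Fin m × Fin n := ((0 : Fin 1), ⟨0, by omega⟩, ⟨0, by omega⟩) with hx₀
  have hMdet : ∀ (w : Fin 1 × Fin m × Fin n → F),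
      eval w M.det = Matrix.det (Matrix.of fun i j : Fin (r + 1) => w (0, ρm i, ρn j)) := by
    intro w
    rw [RingHom.map_det]
    congr 1
    ext i j
    simp [hM, RingHom.mapMatrix_apply, Matrix.map_apply]
  refine ⟨M.det * X x₀ ^ (m - (r + 1)), ?_, ?_, ?_⟩
  · -- nonzero: the minor evaluates to `det 1 = 1` at the "identity" point
    refine mul_ne_zero (fun h0 => ?_) (pow_ne_zero _ (X_ne_zero _))
    have h := congrArg (eval fun p : Fin 1 × Fin m × Fin n => if (p.2.1 : ℕ) = p.2.2 then (1 : F) else 0) h0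
    rw [hMdet, map_zero] at h
    have h1 : (Matrix.of fun i j : Fin (r + 1) =>
        if ((ρm i : ℕ)) = (ρn j : ℕ) then (1 : F) else 0) = 1 := by
      ext i j
      simp only [Matrix.of_apply, hρm, hρn, Matrix.one_apply, Fin.ext_iff]
    rw [h1, Matrix.det_one] at h
    exact one_ne_zero h
  · -- homogeneous of degree `m = (r+1) + (m - (r+1))`
    have h1 : M.det.IsHomogeneous (r + 1) := by
      simpa using isHomogeneous_det_X (F := F) (fun i j : Fin (r + 1) => ((0 : Fin 1), ρm i, ρn j))
    have h2 : (X x₀ ^ (m - (r + 1)) : MvPolynomial (Fin 1 × Fin m × Fin n) F).IsHomogeneous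
        (m - (r + 1)) := by
      simpa using (isHomogeneous_X F x₀).pow (m - (r + 1))
    have := h1.mul h2
    rwa [show r + 1 + (m - (r + 1)) = m by omega] at this
  · -- vanishing on `𝓜_r`: the slice `T 0` has rank `≤ r`
    rintro T ⟨x, hx, hrk⟩
    rw [map_mul, hMdet]
    have hx0 : x 0 ≠ 0 := by
      intro h0; apply hx; funext a; rw [Subsingleton.elim a 0, h0]; rfl
    have hc : contract3 T x = x 0 • (Matrix.of fun b c => T 0 b c) := by
      ext b c
      simp [contract3_apply, Matrix.smul_apply]
    have hsub : (contract3 T x).submatrix ρm ρn =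
        x 0 • Matrix.of fun i j : Fin (r + 1) => T 0 (ρm i) (ρn j) := by
      ext i j; simp [hc, Matrix.submatrix_apply]
    have hdet := det_submatrix_eq_zero_of_rank_le (contract3 T x) hrk ρm ρn
    rw [hsub, Matrix.det_smul, Fintype.card_fin, mul_eq_zero] at hdet
    rcases hdet with hpow | hdet
    · exact absurd (pow_eq_zero_iff (Nat.succ_ne_zero r) |>.mp hpow) hx0
    · have : (Matrix.of fun i j : Fin (r + 1) => trilinearPt T (0, ρm i, ρn j)) =
          Matrix.of fun i j : Fin (r + 1) => T 0 (ρm i) (ρn j) := by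
        ext i j; rfl
      rw [this, hdet, zero_mul]

end BILPS2019

end Literature.Computability.AlgebraicComplexity

end
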